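import Summits.MatrixMultiplication.OmegaCensus.STPP222Pow4Cyclic

/-!
# ω-census, STPP pattern `(2,2,2)⁶` in a cyclic group: kernel witness for `ℤ/128`

HONEST FRAMING (pub-omega census; verbatim): lottery ticket; floor = certified bounds/negative ranges.
Census STRUCTURE bookkeeping (question Q7 of the pub-omega cell: the cyclic onsets `m_k` of `k` simultaneous-TPP triples of
2-subsets, CKSU 2005 Def. 5.1, tree form `IsSTPP`; row Pb59), not progress on `ω`: a `(2,2,2)⁶` family has volume `48` and
certifies no matrix-multiplication bound of interest.

The first `k = 6` witness of the census: SIX simultaneous-TPP triples of 2-subsets in `ℤ/128`, found by this seat (pub-omega-stpp-3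
gen 8, 2026-08-24T08:58Z, hub, 0.56 s) with `t4inv` = the lineage's complete-search engine `t4tiles` v0.2 in the restricted mode
`--inv 6` (every triple contains a coset `{x, x + 64}` of the order-2 subgroup; tile-0 orbit `(1,32,64)`).  Re-checked before
packaging by this seat's two literal Def-5.1 checkers (`6³·2⁶ = 13 824` words, `48` trivial zeros, `0` violations, all eighteen sets
2-element, `36/36` one-element mutants refused) and by the lead's literal leg (cell `STATUS.md` 2026-08-24T09:02Z, Pb59); here it
is put in the kernel (`decide` on `stppCheck`, packaged by `exists_isSTPP_222pow_of_lists`).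
Census reading: `m₆ ≤ 128` (the least cyclic modulus with `(2,2,2)⁶` is at most `128`).  NOT claimed: anything about `m < 128`
(`ℤ/126`, `ℤ/120` had shallow capped probes only, which decide nothing) and no minimality.

References: H. Cohn, R. Kleinberg, B. Szegedy, C. Umans, *Group-theoretic algorithms for matrix multiplication*, FOCS 2005
(arXiv:math/0511460), Def. 5.1.  Record: pub-omega HOME `pub-omega-stpp-3-g8/results/finds-k5/z128_k6_inv6.jsonl` (sha16 1e0c1702176aa911).
-/

open Literature.Computability.AlgebraicComplexity Finset

namespace Summit.MatrixMultiplication.OmegaCensus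

set_option maxHeartbeats 400000 in
/-- `ℤ/128` admits the STPP pattern `(2,2,2)⁶`: six simultaneous-TPP triples of 2-subsets (kernel witness; engine `t4inv` `--inv 6`,
tile-0 orbit `(1,32,64)`; literal re-checks as in the header). [cite: CohnKleinbergSzegedyUmans2005, Def. 5.1] -/
theorem exists_isSTPP_222pow6_zmod128 :
    ∃ A B C : Fin 6 → Finset (ZMod 128), IsSTPP A B C ∧ ∀ i, (A i).card = 2 ∧ (B i).card = 2 ∧ (C i).card = 2 :=
  exists_isSTPP_222pow_of_lists (H := ZMod 128)
    ![[0, 1], [0, 1], [0, 1], [0, 1], [0, 8], [0, 11]]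
    ![[0, 32], [126, 30], [122, 26], [107, 11], [108, 12], [110, 14]]
    ![[0, 64], [2, 66], [6, 70], [21, 85], [27, 91], [28, 92]]
    (by decide +kernel) (by decide +kernel)

end Summit.MatrixMultiplication.OmegaCensus
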